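import Summits.CriticalPhenomena.PercolationContinuityZ3.Theorems.PercNearOneGluingNoHeavyLowerTailKnQuestion8CoefficientwiseHarrisTwice
import HarnessLib

/-!
# The CROSS no-core inequality: `NO-CORE(q)[1_p, g] + NO-CORE(p)[1_q, g] ≥ 0` for all vertices `p, q` — prim-lf-2 gen 49

Support file (`--supports stmt-CriticalPhenomena-4575`, closed), prover `prim-lf-2` (gen 49).  No definitions, no named facts, no sorries; standard axioms.
Memo `prim-lf-2/CW-ANATOMY-gen49.md` §3; CONJECTURE NO-CORE: `prim-lf-2/CW-BOX-gen46.md`, `CW-QMIX-gen47.md`, `CW-HT-gen48.md`.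

Setting.  Finite multigraph `ends : ι → Sym2 V`, root `x`, colourings `s : Finset ι` (red) / `sᶜ` (blue), `K(s) = openCluster (ends '' s) x`, and for monotone `g : Set V → ℝ`,
`ĝ(s) = g(K s) − g(K sᶜ)`.  CONJECTURE NO-CORE (prim-lf-2 gen 46) says that for every vertex `y` and all monotone `f, g`
`NO-CORE(y)[f,g] := Σ_{s : ¬(y ∈ K s ∧ y ∈ K sᶜ)} f̂ ĝ ≥ 0`; for `f = 1_p` it is proved when `y ∼ p` or `y ∼ x` (gens 46, 48) and census-clean in general (all monotone `g`, all
graphs on ≤ 7 vertices).  This file proves, for `f = 1_p`, the exact identity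
  `NO-CORE(q)[1_p, g] = OFF(q)[1_p, g] + Σ_s [p, q ∈ K s ∖ K sᶜ]·ĝ(s) − CR(q;p)`,   `CR(q;p) := Σ_s [q ∈ K s ∖ K sᶜ]·[p ∈ K sᶜ ∖ K s]·ĝ(s)`        (`noCore_pointIndicator_eq`)
where `OFF(q)[1_p,g] = Σ_{s : q ∉ K s} σ_p ĝ ≥ 0` is the OFF-CLUSTER THEOREM of gen 23 (`offCluster_twoColouring_nonneg`), the middle sum is an antithetic kernel with the monotone
coefficient `[p, q ∈ K ∖ K̄]` (`≥ 0`, `AntitheticProduct.sum_mul_sub_compl_nonneg`), and the CROSSING SUM `CR` is ANTISYMMETRIC, `CR(q;p) = −CR(p;q)` (`crossSum_antisymm`, the colour swap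
`s ↦ sᶜ`).  Consequences:
* `noCore_cross_nonneg` — **THEOREM: `NO-CORE(q)[1_p, g] + NO-CORE(p)[1_q, g] ≥ 0` for every finite multigraph, root, vertices `p, q` and monotone `g`** (the crossing sums
  cancel); in particular for every `(G, p, q, g)` at least one of the two cross no-core inequalities holds;
* `noCore_nonneg_of_crossSum_nonpos` — `NO-CORE(q)[1_p, g] ≥ 0` whenever `CR(q;p) ≤ 0`: the whole content of CONJECTURE NO-CORE for point indicators is the one-sided bound
  `CR(q;p) ≤ OFF(q)[1_p] + Σ[p,q ∈ K∖K̄]ĝ` in the orientation where the crossing sum is positive (g 'siding with' the excluded vertex `q` against the spin vertex `p`).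
Where this comes from (memo §3): for `p, q ∈ N(u)` the only `u`-star class of the two-point exclusion `Q_mix(p,q)[1_u]` not signed by `…CoefficientwiseQmixStarClass.lean` is, for
`deg u = 2` and `g` ignoring `u`, EXACTLY `½(NO-CORE(q)[1_p] + NO-CORE(p)[1_q])` on `G − u` (hybrid-spin identity) — so this file also closes that class in the degree-two case.
Exact pre-checks (prim-lf-2 code/gen49/c/cross.c): the identity `2·HYB = CROSS` and `CROSS ≥ 0` on all graphs with ≤ 6 vertices (≤ 9 edges), all `(p,q)`, exact min over all monotone `g`.
[cite: KozmaNitzan2024, Questions 8–9 (§5.5 p. 36) (context: the Question-8 pocket covariance programme)]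
-/

namespace Summit.CriticalPhenomena.PercolationContinuityZ3.Theorems

open Finset Literature.Probability.Percolation

namespace Coefficientwise

variable {ι V : Type*} [Fintype ι] [DecidableEq ι] (ends : ι → Sym2 V) (x : V)

open Classical in
/-- **The crossing sum is antisymmetric:** `Σ_s [q ∈ K s ∖ K sᶜ][p ∈ K sᶜ ∖ K s]·ĝ(s) = − Σ_s [p ∈ K s ∖ K sᶜ][q ∈ K sᶜ ∖ K s]·ĝ(s)` (reindex by the colour swap `s ↦ sᶜ`,
under which `ĝ ↦ −ĝ`).  [cite: KozmaNitzan2024, §5.5 (context only; bookkeeping)] -/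
theorem crossSum_antisymm (p q : V) (g : Set V → ℝ) :
    ∑ s : Finset ι, (if (q ∈ openCluster (ends '' (↑s : Set ι)) x ∧ q ∉ openCluster (ends '' (↑(sᶜ) : Set ι)) x ∧
                          p ∈ openCluster (ends '' (↑(sᶜ) : Set ι)) x ∧ p ∉ openCluster (ends '' (↑s : Set ι)) x) then (1 : ℝ) else 0) *
      (g (openCluster (ends '' (↑s : Set ι)) x) - g (openCluster (ends '' (↑(sᶜ) : Set ι)) x)) =
    - ∑ s : Finset ι, (if (p ∈ openCluster (ends '' (↑s : Set ι)) x ∧ p ∉ openCluster (ends '' (↑(sᶜ) : Set ι)) x ∧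
                          q ∈ openCluster (ends '' (↑(sᶜ) : Set ι)) x ∧ q ∉ openCluster (ends '' (↑s : Set ι)) x) then (1 : ℝ) else 0) *
      (g (openCluster (ends '' (↑s : Set ι)) x) - g (openCluster (ends '' (↑(sᶜ) : Set ι)) x)) := by
  set K : Finset ι → Set V := fun s => openCluster (ends '' (↑s : Set ι)) x with hK
  change ∑ s : Finset ι, (if (q ∈ K s ∧ q ∉ K sᶜ ∧ p ∈ K sᶜ ∧ p ∉ K s) then (1 : ℝ) else 0) * (g (K s) - g (K sᶜ)) =
    - ∑ s : Finset ι, (if (p ∈ K s ∧ p ∉ K sᶜ ∧ q ∈ K sᶜ ∧ q ∉ K s) then (1 : ℝ) else 0) * (g (K s) - g (K sᶜ))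
  rw [← sum_compl_eq (fun s : Finset ι => (if (q ∈ K s ∧ q ∉ K sᶜ ∧ p ∈ K sᶜ ∧ p ∉ K s) then (1 : ℝ) else 0) * (g (K s) - g (K sᶜ))),
    ← Finset.sum_neg_distrib]
  refine Finset.sum_congr rfl fun s _ => ?_
  simp only [compl_compl]
  by_cases h1 : p ∈ K s <;> by_cases h2 : p ∈ K sᶜ <;> by_cases h3 : q ∈ K s <;> by_cases h4 : q ∈ K sᶜ <;> simp [h1, h2, h3, h4]

open Classical in
/-- **The anatomy of `NO-CORE(q)[1_p, g]`:**
`Σ_{s : ¬(q∈Ks ∧ q∈Ksᶜ)} σ_p ĝ = Σ_{s : q ∉ K s} σ_p ĝ + Σ_s [p,q ∈ Ks∖Ksᶜ]·ĝ − Σ_s [q ∈ Ks∖Ksᶜ][p ∈ Ksᶜ∖Ks]·ĝ`  (pointwise bookkeeping: `{q ∉ J} = {q ∉ K} ⊔ {q ∈ K∖K̄}` and on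
`{q ∈ K∖K̄}`, `σ_p = [p ∈ K∖K̄] − [p ∈ K̄∖K]`).  The first sum is written with the avoided SET `{q}` to match `offCluster_twoColouring_nonneg`.
[cite: KozmaNitzan2024, Questions 8–9 (§5.5 p. 36) (context)] -/
theorem noCore_pointIndicator_eq (p q : V) (g : Set V → ℝ) :
    ∑ s ∈ univ.filter (fun s : Finset ι => ¬ (q ∈ openCluster (ends '' (↑s : Set ι)) x ∧ q ∈ openCluster (ends '' (↑(sᶜ) : Set ι)) x)),
      ((if p ∈ openCluster (ends '' (↑s : Set ι)) x then (1 : ℝ) else 0) - (if p ∈ openCluster (ends '' (↑(sᶜ) : Set ι)) x then (1 : ℝ) else 0)) *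
        (g (openCluster (ends '' (↑s : Set ι)) x) - g (openCluster (ends '' (↑(sᶜ) : Set ι)) x)) =
    ∑ s ∈ univ.filter (fun s : Finset ι => ∀ a ∈ ({q} : Set V), a ∉ openCluster (ends '' (↑s : Set ι)) x),
      ((if p ∈ openCluster (ends '' (↑s : Set ι)) x then (1 : ℝ) else 0) - (if p ∈ openCluster (ends '' (↑(sᶜ) : Set ι)) x then (1 : ℝ) else 0)) *
        (g (openCluster (ends '' (↑s : Set ι)) x) - g (openCluster (ends '' (↑(sᶜ) : Set ι)) x))
    + ∑ s : Finset ι, (if (p ∈ openCluster (ends '' (↑s : Set ι)) x ∧ p ∉ openCluster (ends '' (↑(sᶜ) : Set ι)) x ∧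
                          q ∈ openCluster (ends '' (↑s : Set ι)) x ∧ q ∉ openCluster (ends '' (↑(sᶜ) : Set ι)) x) then (1 : ℝ) else 0) *
      (g (openCluster (ends '' (↑s : Set ι)) x) - g (openCluster (ends '' (↑(sᶜ) : Set ι)) x))
    - ∑ s : Finset ι, (if (q ∈ openCluster (ends '' (↑s : Set ι)) x ∧ q ∉ openCluster (ends '' (↑(sᶜ) : Set ι)) x ∧
                          p ∈ openCluster (ends '' (↑(sᶜ) : Set ι)) x ∧ p ∉ openCluster (ends '' (↑s : Set ι)) x) then (1 : ℝ) else 0) *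
      (g (openCluster (ends '' (↑s : Set ι)) x) - g (openCluster (ends '' (↑(sᶜ) : Set ι)) x)) := by
  set K : Finset ι → Set V := fun s => openCluster (ends '' (↑s : Set ι)) x with hK
  set gh : Finset ι → ℝ := fun s => g (K s) - g (K sᶜ) with hgh
  set sp : Finset ι → ℝ := fun s => (if p ∈ K s then (1 : ℝ) else 0) - (if p ∈ K sᶜ then (1 : ℝ) else 0) with hsp
  change ∑ s ∈ univ.filter (fun s : Finset ι => ¬ (q ∈ K s ∧ q ∈ K sᶜ)), sp s * gh s =
    ∑ s ∈ univ.filter (fun s : Finset ι => ∀ a ∈ ({q} : Set V), a ∉ K s), sp s * gh s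
    + ∑ s : Finset ι, (if (p ∈ K s ∧ p ∉ K sᶜ ∧ q ∈ K s ∧ q ∉ K sᶜ) then (1 : ℝ) else 0) * gh s
    - ∑ s : Finset ι, (if (q ∈ K s ∧ q ∉ K sᶜ ∧ p ∈ K sᶜ ∧ p ∉ K s) then (1 : ℝ) else 0) * gh s
  have hfilt : univ.filter (fun s : Finset ι => ∀ a ∈ ({q} : Set V), a ∉ K s) = univ.filter (fun s : Finset ι => q ∉ K s) := by
    refine Finset.filter_congr fun s _ => ?_
    simp only [Set.mem_singleton_iff, forall_eq]
  rw [hfilt, Finset.sum_filter, Finset.sum_filter, ← Finset.sum_add_distrib, ← Finset.sum_sub_distrib]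
  refine Finset.sum_congr rfl fun s _ => ?_
  simp only [hsp]
  by_cases h1 : p ∈ K s <;> by_cases h2 : p ∈ K sᶜ <;> by_cases h3 : q ∈ K s <;> by_cases h4 : q ∈ K sᶜ <;> simp [h1, h2, h3, h4]

open Classical in
/-- **The kernel of the cross identity:** `0 ≤ Σ_s [p ∈ Ks∖Ksᶜ ∧ q ∈ Ks∖Ksᶜ]·(g(K s) − g(K sᶜ))` for monotone `g` — the coefficient is monotone in `s`, so this is the antithetic kernel
`AntitheticProduct.sum_mul_sub_compl_nonneg`.  [cite: KozmaNitzan2024, Questions 8–9 (§5.5 p. 36) (context)] -/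
theorem bothRedOnly_kernel_nonneg (p q : V) (g : Set V → ℝ) (hg : Monotone g) :
    0 ≤ ∑ s : Finset ι, (if (p ∈ openCluster (ends '' (↑s : Set ι)) x ∧ p ∉ openCluster (ends '' (↑(sᶜ) : Set ι)) x ∧
                          q ∈ openCluster (ends '' (↑s : Set ι)) x ∧ q ∉ openCluster (ends '' (↑(sᶜ) : Set ι)) x) then (1 : ℝ) else 0) *
      (g (openCluster (ends '' (↑s : Set ι)) x) - g (openCluster (ends '' (↑(sᶜ) : Set ι)) x)) := by
  set K : Finset ι → Set V := fun s => openCluster (ends '' (↑s : Set ι)) x with hK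
  have hKmono : ∀ {s t : Finset ι}, s ⊆ t → K s ⊆ K t := fun hst => openCluster_image_mono ends hst x
  refine AntitheticProduct.sum_mul_sub_compl_nonneg
    (fun s : Finset ι => if (p ∈ K s ∧ p ∉ K sᶜ ∧ q ∈ K s ∧ q ∉ K sᶜ) then (1 : ℝ) else 0)
    (fun s : Finset ι => g (K s)) ?_ (fun s t hst => hg (hKmono hst))
  intro s t hst
  have hc : K tᶜ ⊆ K sᶜ := hKmono (compl_subset_compl.mpr hst)
  by_cases hs : p ∈ K s ∧ p ∉ K sᶜ ∧ q ∈ K s ∧ q ∉ K sᶜ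
  · have ht : p ∈ K t ∧ p ∉ K tᶜ ∧ q ∈ K t ∧ q ∉ K tᶜ :=
      ⟨hKmono hst hs.1, fun h => hs.2.1 (hc h), hKmono hst hs.2.2.1, fun h => hs.2.2.2 (hc h)⟩
    simp [hs, ht]
  · simp only [hs, if_false]; split_ifs <;> norm_num

open Classical in
/-- **THEOREM (the CROSS no-core inequality).**  For every finite multigraph, root `x`, vertices `p, q` and monotone `g : Set V → ℝ`:
`0 ≤ NO-CORE(q)[1_p, g] + NO-CORE(p)[1_q, g]`, i.e.
`0 ≤ Σ_{s : ¬(q∈Ks ∧ q∈Ksᶜ)} ([p∈Ks] − [p∈Ksᶜ])·ĝ(s) + Σ_{s : ¬(p∈Ks ∧ p∈Ksᶜ)} ([q∈Ks] − [q∈Ksᶜ])·ĝ(s)`.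
Proof: by `noCore_pointIndicator_eq` twice, the two crossing sums cancel (`crossSum_antisymm`) and what remains is `OFF(q)[1_p] + OFF(p)[1_q] + 2·Σ[p,q ∈ K∖K̄]ĝ`, a sum of two
off-cluster sums (`offCluster_twoColouring_nonneg`, gen 23) and an antithetic kernel (`bothRedOnly_kernel_nonneg`).  Each summand `NO-CORE(q)[1_p,g]`, `NO-CORE(p)[1_q,g]` alone is an
open instance of CONJECTURE NO-CORE.  [cite: KozmaNitzan2024, Questions 8–9 (§5.5 p. 36) (context)] -/
theorem noCore_cross_nonneg (p q : V) (g : Set V → ℝ) (hg : Monotone g) :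
    0 ≤ ∑ s ∈ univ.filter (fun s : Finset ι => ¬ (q ∈ openCluster (ends '' (↑s : Set ι)) x ∧ q ∈ openCluster (ends '' (↑(sᶜ) : Set ι)) x)),
        ((if p ∈ openCluster (ends '' (↑s : Set ι)) x then (1 : ℝ) else 0) - (if p ∈ openCluster (ends '' (↑(sᶜ) : Set ι)) x then (1 : ℝ) else 0)) *
          (g (openCluster (ends '' (↑s : Set ι)) x) - g (openCluster (ends '' (↑(sᶜ) : Set ι)) x))
      + ∑ s ∈ univ.filter (fun s : Finset ι => ¬ (p ∈ openCluster (ends '' (↑s : Set ι)) x ∧ p ∈ openCluster (ends '' (↑(sᶜ) : Set ι)) x)),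
        ((if q ∈ openCluster (ends '' (↑s : Set ι)) x then (1 : ℝ) else 0) - (if q ∈ openCluster (ends '' (↑(sᶜ) : Set ι)) x then (1 : ℝ) else 0)) *
          (g (openCluster (ends '' (↑s : Set ι)) x) - g (openCluster (ends '' (↑(sᶜ) : Set ι)) x)) := by
  rw [noCore_pointIndicator_eq ends x p q g, noCore_pointIndicator_eq ends x q p g, crossSum_antisymm ends x q p g]
  have h1 := offCluster_twoColouring_nonneg ends x ({q} : Set V) (fun C => if p ∈ C then (1 : ℝ) else 0) g
    (fun a b hab => by
      show (if p ∈ a then (1 : ℝ) else 0) ≤ (if p ∈ b then (1 : ℝ) else 0)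
      by_cases ha : p ∈ a
      · simp [ha, hab ha]
      · simp only [ha, if_false]; split_ifs <;> norm_num) hg
  have h2 := offCluster_twoColouring_nonneg ends x ({p} : Set V) (fun C => if q ∈ C then (1 : ℝ) else 0) g
    (fun a b hab => by
      show (if q ∈ a then (1 : ℝ) else 0) ≤ (if q ∈ b then (1 : ℝ) else 0)
      by_cases ha : q ∈ a
      · simp [ha, hab ha]
      · simp only [ha, if_false]; split_ifs <;> norm_num) hg
  have h3 := bothRedOnly_kernel_nonneg ends x p q g hg
  have h4 := bothRedOnly_kernel_nonneg ends x q p g hg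
  linarith

open Classical in
/-- **Corollary: `NO-CORE(q)[1_p, g] ≥ 0` whenever the crossing sum `CR(q;p) = Σ_s [q ∈ Ks∖Ksᶜ][p ∈ Ksᶜ∖Ks]·ĝ(s)` is `≤ 0`** (then every term of `noCore_pointIndicator_eq` is signed).
Since `CR(q;p) = −CR(p;q)`, for every `(G, x, p, q, g)` this settles at least one of the two cross instances of CONJECTURE NO-CORE outright.
[cite: KozmaNitzan2024, Questions 8–9 (§5.5 p. 36) (context)] -/
theorem noCore_nonneg_of_crossSum_nonpos (p q : V) (g : Set V → ℝ) (hg : Monotone g)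
    (hCR : ∑ s : Finset ι, (if (q ∈ openCluster (ends '' (↑s : Set ι)) x ∧ q ∉ openCluster (ends '' (↑(sᶜ) : Set ι)) x ∧
                          p ∈ openCluster (ends '' (↑(sᶜ) : Set ι)) x ∧ p ∉ openCluster (ends '' (↑s : Set ι)) x) then (1 : ℝ) else 0) *
      (g (openCluster (ends '' (↑s : Set ι)) x) - g (openCluster (ends '' (↑(sᶜ) : Set ι)) x)) ≤ 0) :
    0 ≤ ∑ s ∈ univ.filter (fun s : Finset ι => ¬ (q ∈ openCluster (ends '' (↑s : Set ι)) x ∧ q ∈ openCluster (ends '' (↑(sᶜ) : Set ι)) x)),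
        ((if p ∈ openCluster (ends '' (↑s : Set ι)) x then (1 : ℝ) else 0) - (if p ∈ openCluster (ends '' (↑(sᶜ) : Set ι)) x then (1 : ℝ) else 0)) *
          (g (openCluster (ends '' (↑s : Set ι)) x) - g (openCluster (ends '' (↑(sᶜ) : Set ι)) x)) := by
  rw [noCore_pointIndicator_eq ends x p q g]
  have h1 := offCluster_twoColouring_nonneg ends x ({q} : Set V) (fun C => if p ∈ C then (1 : ℝ) else 0) g
    (fun a b hab => by
      show (if p ∈ a then (1 : ℝ) else 0) ≤ (if p ∈ b then (1 : ℝ) else 0)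
      by_cases ha : p ∈ a
      · simp [ha, hab ha]
      · simp only [ha, if_false]; split_ifs <;> norm_num) hg
  have h3 := bothRedOnly_kernel_nonneg ends x p q g hg
  linarith

open Classical in
/-- **The double CROSS criterion for the point functions.**  For the lineage's point pair (`f = 1_u`, `g = 1_w`) and any vertex `y`:
`NO-CORE(y)[1_u, 1_w] = Σ_{s : ¬(y∈Ks ∧ y∈Ksᶜ)} σ_u σ_w ≥ 0` as soon as ONE of the two crossing sums `CR(y;u)[1_w] = Σ_s [y∈Ks∖Ksᶜ][u∈Ksᶜ∖Ks]·σ_w`,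
`CR(y;w)[1_u] = Σ_s [y∈Ks∖Ksᶜ][w∈Ksᶜ∖Ks]·σ_u` is `≤ 0` (`noCore_nonneg_of_crossSum_nonpos` for `(p,g) = (u,1_w)`, resp. `(w,1_u)` and the `f ↔ g` symmetry of the summand).
Census (prim-lf-2 code/gen49/c/crcov2.c): this settles 99.7 / 99.1 / 97.8 % of all `(G,y,u,w)` on 5 / 6 / 7 vertices (≤ 10 / ≤ 11 / ≤ 9 edges; 17 472 / 1 567 680 / 59 973 840 instances) and
94.7 / 91.1 / 89.7 % of those with `y` adjacent to none of `x, u, w` (where no earlier theorem applies).  [cite: KozmaNitzan2024, Questions 8–9 (§5.5 p. 36) (context)] -/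
theorem noCore_points_nonneg_of_crossSum (y u w : V)
    (h : (∑ s : Finset ι, (if (y ∈ openCluster (ends '' (↑s : Set ι)) x ∧ y ∉ openCluster (ends '' (↑(sᶜ) : Set ι)) x ∧
                          u ∈ openCluster (ends '' (↑(sᶜ) : Set ι)) x ∧ u ∉ openCluster (ends '' (↑s : Set ι)) x) then (1 : ℝ) else 0) *
          ((if w ∈ openCluster (ends '' (↑s : Set ι)) x then (1 : ℝ) else 0) - (if w ∈ openCluster (ends '' (↑(sᶜ) : Set ι)) x then (1 : ℝ) else 0)) ≤ 0) ∨
         (∑ s : Finset ι, (if (y ∈ openCluster (ends '' (↑s : Set ι)) x ∧ y ∉ openCluster (ends '' (↑(sᶜ) : Set ι)) x ∧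
                          w ∈ openCluster (ends '' (↑(sᶜ) : Set ι)) x ∧ w ∉ openCluster (ends '' (↑s : Set ι)) x) then (1 : ℝ) else 0) *
          ((if u ∈ openCluster (ends '' (↑s : Set ι)) x then (1 : ℝ) else 0) - (if u ∈ openCluster (ends '' (↑(sᶜ) : Set ι)) x then (1 : ℝ) else 0)) ≤ 0)) :
    0 ≤ ∑ s ∈ univ.filter (fun s : Finset ι => ¬ (y ∈ openCluster (ends '' (↑s : Set ι)) x ∧ y ∈ openCluster (ends '' (↑(sᶜ) : Set ι)) x)),
        ((if u ∈ openCluster (ends '' (↑s : Set ι)) x then (1 : ℝ) else 0) - (if u ∈ openCluster (ends '' (↑(sᶜ) : Set ι)) x then (1 : ℝ) else 0)) *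
        ((if w ∈ openCluster (ends '' (↑s : Set ι)) x then (1 : ℝ) else 0) - (if w ∈ openCluster (ends '' (↑(sᶜ) : Set ι)) x then (1 : ℝ) else 0)) := by
  have hmono : ∀ v : V, Monotone (fun C : Set V => if v ∈ C then (1 : ℝ) else 0) := by
    intro v a b hab
    show (if v ∈ a then (1 : ℝ) else 0) ≤ (if v ∈ b then (1 : ℝ) else 0)
    by_cases ha : v ∈ a
    · simp [ha, hab ha]
    · simp only [ha, if_false]; split_ifs <;> norm_num
  rcases h with h | h
  · exact noCore_nonneg_of_crossSum_nonpos ends x u y (fun C : Set V => if w ∈ C then (1 : ℝ) else 0) (hmono w) h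
  · have h2 := noCore_nonneg_of_crossSum_nonpos ends x w y (fun C : Set V => if u ∈ C then (1 : ℝ) else 0) (hmono u) h
    refine le_trans h2 (le_of_eq (Finset.sum_congr rfl fun s _ => ?_))
    ring


open Classical in
/-- **The anatomy of `NO-CORE(q)[f, g]` for a GENERAL monotone `f`.**  With `f̂⁺(s) := max(f(K s) − f(K sᶜ), 0)`:
`Σ_{s : ¬(q∈Ks ∧ q∈Ksᶜ)} f̂ ĝ = Σ_{s : q ∉ K s} f̂ ĝ + Σ_s [q ∈ Ks ∖ Ksᶜ]·f̂⁺(s)·ĝ(s) + Σ_s [q ∈ Ksᶜ ∖ Ks]·f̂⁺(s)·ĝ(s)`: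
on `{q ∈ K∖K̄}` write `f̂ = f̂⁺ − f̂⁻` and fold the `f̂⁻` part through the colour swap (`f̂⁻(sᶜ) = f̂⁺(s)`, `ĝ(sᶜ) = −ĝ(s)`).  The first sum is the off-cluster sum (`≥ 0`, gen 23), the
second an antithetic kernel (`f̂⁺` is monotone and `≥ 0`), the third — the general CROSSING TERM `X(f) := Σ_{q ∈ K̄∖K} f̂⁺ ĝ` — carries the whole difficulty of CONJECTURE NO-CORE
(for `f = 1_p` it is `−CR(q;p)` of `noCore_pointIndicator_eq`).  [cite: KozmaNitzan2024, Questions 8–9 (§5.5 p. 36) (context)] -/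
theorem noCore_eq_off_add_kernel_add_cross (q : V) (f g : Set V → ℝ) :
    ∑ s ∈ univ.filter (fun s : Finset ι => ¬ (q ∈ openCluster (ends '' (↑s : Set ι)) x ∧ q ∈ openCluster (ends '' (↑(sᶜ) : Set ι)) x)),
      (f (openCluster (ends '' (↑s : Set ι)) x) - f (openCluster (ends '' (↑(sᶜ) : Set ι)) x)) *
        (g (openCluster (ends '' (↑s : Set ι)) x) - g (openCluster (ends '' (↑(sᶜ) : Set ι)) x)) =
    ∑ s ∈ univ.filter (fun s : Finset ι => ∀ a ∈ ({q} : Set V), a ∉ openCluster (ends '' (↑s : Set ι)) x),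
      (f (openCluster (ends '' (↑s : Set ι)) x) - f (openCluster (ends '' (↑(sᶜ) : Set ι)) x)) *
        (g (openCluster (ends '' (↑s : Set ι)) x) - g (openCluster (ends '' (↑(sᶜ) : Set ι)) x))
    + ∑ s : Finset ι, (if (q ∈ openCluster (ends '' (↑s : Set ι)) x ∧ q ∉ openCluster (ends '' (↑(sᶜ) : Set ι)) x) then (1 : ℝ) else 0) *
        max (f (openCluster (ends '' (↑s : Set ι)) x) - f (openCluster (ends '' (↑(sᶜ) : Set ι)) x)) 0 *
        (g (openCluster (ends '' (↑s : Set ι)) x) - g (openCluster (ends '' (↑(sᶜ) : Set ι)) x))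
    + ∑ s : Finset ι, (if (q ∈ openCluster (ends '' (↑(sᶜ) : Set ι)) x ∧ q ∉ openCluster (ends '' (↑s : Set ι)) x) then (1 : ℝ) else 0) *
        max (f (openCluster (ends '' (↑s : Set ι)) x) - f (openCluster (ends '' (↑(sᶜ) : Set ι)) x)) 0 *
        (g (openCluster (ends '' (↑s : Set ι)) x) - g (openCluster (ends '' (↑(sᶜ) : Set ι)) x)) := by
  set K : Finset ι → Set V := fun s => openCluster (ends '' (↑s : Set ι)) x with hK
  set fh : Finset ι → ℝ := fun s => f (K s) - f (K sᶜ) with hfh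
  set gh : Finset ι → ℝ := fun s => g (K s) - g (K sᶜ) with hgh
  change ∑ s ∈ univ.filter (fun s : Finset ι => ¬ (q ∈ K s ∧ q ∈ K sᶜ)), fh s * gh s =
    ∑ s ∈ univ.filter (fun s : Finset ι => ∀ a ∈ ({q} : Set V), a ∉ K s), fh s * gh s
    + ∑ s : Finset ι, (if (q ∈ K s ∧ q ∉ K sᶜ) then (1 : ℝ) else 0) * max (fh s) 0 * gh s
    + ∑ s : Finset ι, (if (q ∈ K sᶜ ∧ q ∉ K s) then (1 : ℝ) else 0) * max (fh s) 0 * gh s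
  have hfilt : univ.filter (fun s : Finset ι => ∀ a ∈ ({q} : Set V), a ∉ K s) = univ.filter (fun s : Finset ι => q ∉ K s) := by
    refine Finset.filter_congr fun s _ => ?_
    simp only [Set.mem_singleton_iff, forall_eq]
  -- the blue-only part with `max (fh s) 0` equals, after the swap, minus the red-only part with `max (−fh s) 0`
  have hswap : ∑ s : Finset ι, (if (q ∈ K sᶜ ∧ q ∉ K s) then (1 : ℝ) else 0) * max (fh s) 0 * gh s =
      - ∑ s : Finset ι, (if (q ∈ K s ∧ q ∉ K sᶜ) then (1 : ℝ) else 0) * max (- fh s) 0 * gh s := by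
    rw [← sum_compl_eq (fun s : Finset ι => (if (q ∈ K sᶜ ∧ q ∉ K s) then (1 : ℝ) else 0) * max (fh s) 0 * gh s), ← Finset.sum_neg_distrib]
    refine Finset.sum_congr rfl fun s _ => ?_
    have hf' : fh sᶜ = - fh s := by simp only [hfh, compl_compl]; ring
    have hg' : gh sᶜ = - gh s := by simp only [hgh, compl_compl]; ring
    simp only [compl_compl, hf', hg']
    ring
  rw [hfilt, hswap, Finset.sum_filter, Finset.sum_filter, ← sub_eq_add_neg, ← Finset.sum_add_distrib, ← Finset.sum_sub_distrib]
  refine Finset.sum_congr rfl fun s _ => ?_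
  have hmax : max (fh s) 0 - max (- fh s) 0 = fh s := by
    rcases le_total 0 (fh s) with h | h
    · rw [max_eq_left h, max_eq_right (by linarith)]; ring
    · rw [max_eq_right h, max_eq_left (by linarith)]; ring
  have key : max (fh s) 0 * gh s - max (- fh s) 0 * gh s = fh s * gh s := by rw [← sub_mul, hmax]
  by_cases h3 : q ∈ K s <;> by_cases h4 : q ∈ K sᶜ
  · rw [if_neg (fun h => h ⟨h3, h4⟩), if_neg (fun h => h h3), if_neg (fun h => h.2 h4)]; ring
  · rw [if_pos (fun h => h4 h.2), if_neg (fun h => h h3), if_pos ⟨h3, h4⟩]; linarith [key]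
  · rw [if_pos (fun h => h3 h.1), if_pos h3, if_neg (fun h => h3 h.1)]; ring
  · rw [if_pos (fun h => h3 h.1), if_pos h3, if_neg (fun h => h3 h.1)]; ring

open Classical in
/-- **General crossing criterion.**  For ALL monotone `f, g` and every vertex `q`: if the crossing term `X(f,g) = Σ_{s : q ∈ Ksᶜ∖Ks} f̂⁺(s)·ĝ(s)` is `≥ 0`, then
`NO-CORE(q)[f,g] ≥ 0` (by `noCore_eq_off_add_kernel_add_cross`: off-cluster sum + antithetic kernel with the monotone nonnegative coefficient `[q ∈ K∖K̄]·f̂⁺` + `X`).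
For `f = 1_p` this is `noCore_nonneg_of_crossSum_nonpos`.  [cite: KozmaNitzan2024, Questions 8–9 (§5.5 p. 36) (context)] -/
theorem noCore_nonneg_of_cross_nonneg (q : V) (f g : Set V → ℝ) (hf : Monotone f) (hg : Monotone g)
    (hX : 0 ≤ ∑ s : Finset ι, (if (q ∈ openCluster (ends '' (↑(sᶜ) : Set ι)) x ∧ q ∉ openCluster (ends '' (↑s : Set ι)) x) then (1 : ℝ) else 0) *
        max (f (openCluster (ends '' (↑s : Set ι)) x) - f (openCluster (ends '' (↑(sᶜ) : Set ι)) x)) 0 *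
        (g (openCluster (ends '' (↑s : Set ι)) x) - g (openCluster (ends '' (↑(sᶜ) : Set ι)) x))) :
    0 ≤ ∑ s ∈ univ.filter (fun s : Finset ι => ¬ (q ∈ openCluster (ends '' (↑s : Set ι)) x ∧ q ∈ openCluster (ends '' (↑(sᶜ) : Set ι)) x)),
      (f (openCluster (ends '' (↑s : Set ι)) x) - f (openCluster (ends '' (↑(sᶜ) : Set ι)) x)) *
        (g (openCluster (ends '' (↑s : Set ι)) x) - g (openCluster (ends '' (↑(sᶜ) : Set ι)) x)) := by
  rw [noCore_eq_off_add_kernel_add_cross ends x q f g]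
  set K : Finset ι → Set V := fun s => openCluster (ends '' (↑s : Set ι)) x with hK
  have hKmono : ∀ {s t : Finset ι}, s ⊆ t → K s ⊆ K t := fun hst => openCluster_image_mono ends hst x
  have h1 := offCluster_twoColouring_nonneg ends x ({q} : Set V) f g hf hg
  -- the kernel: coefficient [q ∈ K∖K̄]·max(f̂,0) is monotone
  have h2 : 0 ≤ ∑ s : Finset ι, (if (q ∈ K s ∧ q ∉ K sᶜ) then (1 : ℝ) else 0) * max (f (K s) - f (K sᶜ)) 0 * (g (K s) - g (K sᶜ)) := by
    have := AntitheticProduct.sum_mul_sub_compl_nonneg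
      (fun s : Finset ι => (if (q ∈ K s ∧ q ∉ K sᶜ) then (1 : ℝ) else 0) * max (f (K s) - f (K sᶜ)) 0)
      (fun s : Finset ι => g (K s)) ?_ (fun s t hst => hg (hKmono hst))
    · refine le_of_le_of_eq this (Finset.sum_congr rfl fun s _ => ?_); ring
    intro s t hst
    have hc : K tᶜ ⊆ K sᶜ := hKmono (compl_subset_compl.mpr hst)
    have hfst : f (K s) - f (K sᶜ) ≤ f (K t) - f (K tᶜ) := by
      have := hf (hKmono hst); have := hf hc; linarith
    have hm : max (f (K s) - f (K sᶜ)) 0 ≤ max (f (K t) - f (K tᶜ)) 0 := max_le_max hfst (le_refl 0)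
    have hm0 : 0 ≤ max (f (K s) - f (K sᶜ)) 0 := le_max_right _ _
    have hm0' : 0 ≤ max (f (K t) - f (K tᶜ)) 0 := le_max_right _ _
    show (if (q ∈ K s ∧ q ∉ K sᶜ) then (1 : ℝ) else 0) * max (f (K s) - f (K sᶜ)) 0 ≤
      (if (q ∈ K t ∧ q ∉ K tᶜ) then (1 : ℝ) else 0) * max (f (K t) - f (K tᶜ)) 0
    by_cases hs : q ∈ K s ∧ q ∉ K sᶜ
    · have ht : q ∈ K t ∧ q ∉ K tᶜ := ⟨hKmono hst hs.1, fun h => hs.2 (hc h)⟩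
      simp [hs, ht, hm]
    · simp only [hs, if_false, zero_mul]
      split_ifs
      · linarith [hm0']
      · simp
  simp only [hK] at h2
  linarith

end Coefficientwise

end Summit.CriticalPhenomena.PercolationContinuityZ3.Theorems
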